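import Summits.ABC.IUTFork.Repair.RHSzpiroBadCutFreyReyssatAll
import Summits.ABC.IUTFork.Repair.RHSzpiroBadCutFreyResidueF18
import HarnessLib

/-!
# R-H row 2 / ROUND 2 Q3 (frey family, WINDOW half): every Frey–Legendre point is IN THE WINDOW at every prime `l ≥ l₀^win(P) := max_p p^{⌈h_p/16⌉−1}`
# — kernel closed form of the degree-aware criterion; the Reyssat triple and F18 are in the window at EVERY admissible `l`

PROOF-ONLY file (0 definitions, no instance, no notation) of the abc-iut cell (D-0079 rescue sub-cell R-H, seat abc-iut-rh-typ-2 gen 2; round 2, question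
Q3 «is genuine data always in Σ for l ≫ 0?», frey family, the WINDOW conjunct of Σ₂₇ = «frey: szpiro-bad ∧ window»); sequel to parts 1–4
(`RHSzpiroBadCutFreyResidue` p469508, `…F18` p469621, `…WindowDegree` p470979, `…ReyssatAll` p471800). TAKES NO SIDE on [IUTchIII] Cor. 3.12 or on any author.

CLOSED FORM. Part 3's degree-aware window criterion asks, per bad prime `p` of a rational point, `h_p·(l−3)(l+1) ≤ 8l((l+1)(k_p+2)+1)` for some `k_p` with
`p^{k_p} ≤ l(l²−1)`. With `k_p := 2·⌊log_p l⌋` (`p^{k_p} ≤ l² ≤ l(l²−1)` for `l ≥ 2`) this is implied by **`h_p ≤ 16·(⌊log_p l⌋ + 1)`**, hence by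
**`p^{⌈h_p/16⌉ − 1} ≤ l`**. So:
* `not_deep_ratPoint_of_localHeight_le_log` — if every pole `p` of `j(q)` has `e_p ≤ 16(⌊log_p l⌋+1)`, EVERY Θ-volume datum at `(ratPoint q, l)` satisfies the window
  guard (¬deep) of `H⋆₂` / `hSHwBad` VERBATIM;
* **`not_deep_ratPoint_of_pow_le`** — the same under `p^{(e_p+15)/16 − 1} ≤ l` for every pole `p`: a Frey–Legendre datum is in the window at EVERY `l ≥
  l₀^win(P) := max_p p^{⌈h_p/16⌉−1}` (Q3, window half: YES per datum, explicit `l₀`; over R-W's 37 Szpiro-bad triples `l₀^win ≤ 3⁴ = 81`, attained at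
  `h₃ = 76`; for 30 of them `l₀^win ≤ 5`, i.e. the window holds at every admissible `l` — desk count, kernel instances below for two);
* `not_deep_reyssat` — the Reyssat triple `2 + 3¹⁰·109 = 23⁵` (`h = (20, 10, 2)`, `l₀^win = 3`) is in the window at EVERY `l` for which a Θ-volume datum is typed
  (`l ≥ 5` is read off the datum); `not_deep_F18` — likewise F18 (`h ≤ 18`, `l₀^win = 167⁰·… = 3`).
READING (numbers about OUR typed objects): the window conjunct never removes a Frey datum from Σ₂₇ in the tail; whether the datum is Szpiro-bad at `l`
is the certificate of parts 1/3 per `l` (the guard's coefficients tend to `6` and `6·log π`, so a triple with `Σ_p (h_p − 6) log p > 6 log π` over its odd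
poles is Szpiro-bad at all large `l ∉` poles — not typed here). Existence of Θ-data is NOT claimed anywhere.
HONEST FRAMING: hypotheses / predicates, never asserted; NOTHING here asserts that abc is proved or refuted or takes a side on [IUTchIII] Cor. 3.12 or on any
author; typed ≠ proved. [cite: Mochizuki2012, IUTchI Def. 3.1 (c) p. 61; IUTchIII Cor. 3.12 p. 173–174; IUTchIV Thm. 1.10 p. 22–24, Cor. 2.2 (ii) proof p. 45–46]
[cite: MochizukiGenEll2010, Def. 3.3 p. 12] [cite: DupuyHilado2025, §3.3, §3.4] [claim: Mochizuki2012, status: disputed] for every IUT locution. Axioms: standard.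
-/

noncomputable section

open Set Function NumberField IsDedekindDomain
open scoped Pointwise

namespace Summit.ABC.IUTFork.Repair.RHSzpiroBadCutFreyResidue

open Thm311 Thm311.Real Cor312 Cor312Vol Cor312Prov Literature.IUT.LogThetaLattice Literature.IUT.LogVolume
  Literature.IUT.HodgeTheaters Literature.IUT.LogVolume.ThetaData Literature.AnabelianGeometry.AbsoluteAnabelian
open Literature.NumberTheory.DiophantineGeometry.GenEll Summit.ABC.IUTFork.Conditional
open Summit.ABC.IUTFork.Repair.RHSzpiroBadCut Summit.ABC.IUTFork.Repair.RHSzpiroBadCutFreyFamily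

section RatPoint

variable {q : ℚ} {N Dn : ℕ} {I : Finset ℕ} {e : ℕ → ℕ}

/-- The arithmetic of the closed form: for naturals `h, L, l` with `h ≤ 16(L+1)` and `5 ≤ l`, `h·(l−3)(l+1) ≤ 8l((l+1)(2L+2)+1)` (over `ℝ`). [folklore] -/
theorem mul_le_window_of_le_sixteen_mul {h L l : ℕ} (hh : h ≤ 16 * (L + 1)) (h5 : 5 ≤ l) :
    (h : ℝ) * (((l : ℝ) - 3) * ((l : ℝ) + 1)) ≤ 8 * (l : ℝ) * (((l : ℝ) + 1) * (((2 * L : ℕ) : ℝ) + 2) + 1) := by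
  have hh' : (h : ℝ) ≤ 16 * ((L : ℝ) + 1) := by exact_mod_cast hh
  have hl5 : (5 : ℝ) ≤ l := by exact_mod_cast h5
  have hL0 : (0 : ℝ) ≤ L := Nat.cast_nonneg _
  push_cast
  nlinarith [mul_le_mul_of_nonneg_right hh' (by nlinarith : (0 : ℝ) ≤ ((l : ℝ) - 3) * ((l : ℝ) + 1))]

/-- **WINDOW from `h_p ≤ 16(⌊log_p l⌋ + 1)`**: at a rational point with factorised pole divisor, if every pole `p` of `j(q)` has `e_p ≤ 16·(Nat.log p l + 1)`, then
EVERY genuine Θ-volume datum at `(ratPoint q, l)` satisfies the window guard (¬deep) VERBATIM — part 3's degree-aware criterion with `k_p = 2⌊log_p l⌋`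
(`p^{k_p} ≤ l² ≤ l(l²−1)`). [cite: Mochizuki2012, IUTchIII Cor. 3.12 p. 173–174; IUTchIV Thm. 1.10 p. 22–24; IUTchI Def. 3.1 (c) p. 61] [claim: Mochizuki2012, status: disputed] -/
theorem not_deep_ratPoint_of_localHeight_le_log {l : ℕ} (T : Cor22.ThetaVolumeDatumAt (ratPoint q) l)
    (hI : ∀ p ∈ I, p.Prime) (hD : Dn = ∏ p ∈ I, p ^ e p) (hj : Cor22.jInv q = (N : ℚ) / (Dn : ℚ)) (hN : N ≠ 0)
    (hcop : ∀ p ∈ I, ¬ p ∣ N) (hle : ∀ p ∈ I, e p ≤ 16 * (Nat.log p l + 1)) :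
    letI := T.instFieldF; letI := T.instNumberFieldF; letI := T.instAlgebraF; letI := T.instFieldK
    letI := T.instNumberFieldK; letI := T.instAlgebraK; letI := T.instFieldFbar; letI := T.instAlgebraFbar
    letI := T.instAlgebraKFbar; letI := T.instIsElliptic
    ¬ (∃ (pp : Nat.Primes) (_ : 2 < (pp : ℕ)) (i : Fin (thetaIndex (pilotDataOfK T.D T.K)).lstar)
        (x₀ : (thetaIndex (pilotDataOfK T.D T.K)).Fibre (.inr pp)),
      haveI : Fact (pp : ℕ).Prime := ⟨pp.2⟩
      ((pp : ℕ) : ℝ) ^ ((((i : ℕ) : ℝ) + 2) * (4 + 2 * Real.logb (pp : ℕ) (Module.finrank ℚ T.K)) + 1) *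
        ‖(exists_realising_qIdeles_pilotDataOfK T.D).choose pp x₀‖ ^ (((i : ℕ) + 1) ^ 2 - 1) < 1) := by
  letI := T.instFieldF; letI := T.instNumberFieldF; letI := T.instAlgebraF; letI := T.instFieldK
  letI := T.instNumberFieldK; letI := T.instAlgebraK; letI := T.instFieldFbar; letI := T.instAlgebraFbar
  letI := T.instAlgebraKFbar; letI := T.instIsElliptic
  have h5 : 5 ≤ l := T.D.five_le_l
  refine not_deep_ratPoint_of_factorisation_of_pow_le T hI hD hj hN hcop (fun p => 2 * Nat.log p l) (fun p hp => ?_) (fun p hp => ?_)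
  · -- `p^{2⌊log_p l⌋} ≤ l² ≤ l(l²−1)`
    have hl0 : l ≠ 0 := by omega
    have h1 : p ^ Nat.log p l ≤ l := Nat.pow_log_le_self p hl0
    have h2 : l * l ≤ l * (l ^ 2 - 1) := by
      apply Nat.mul_le_mul_left
      have : l ≤ l ^ 2 - 1 := by
        have hsq : l ^ 2 = l * l := by ring
        rw [hsq]
        have : l * 2 ≤ l * l := Nat.mul_le_mul_left l (by omega)
        omega
      exact this
    calc p ^ (2 * Nat.log p l) = (p ^ Nat.log p l) * (p ^ Nat.log p l) := by ring
      _ ≤ l * l := Nat.mul_le_mul h1 h1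
      _ ≤ l * (l ^ 2 - 1) := h2
  · exact mul_le_window_of_le_sixteen_mul (hle p hp) h5

/-- **Q3, frey family, WINDOW half — YES per datum with explicit `l₀`**: at a rational point with factorised pole divisor, if every pole `p` of `j(q)` has
`p^{⌈e_p/16⌉ − 1} ≤ l` (written `p ^ ((e_p + 15)/16 − 1) ≤ l`), then EVERY genuine Θ-volume datum at `(ratPoint q, l)` is in the window. I.e. a Frey–Legendre
datum sits in the window at EVERY `l ≥ l₀^win(P) := max_p p^{⌈h_p/16⌉−1}`. [cite: Mochizuki2012, IUTchIII Cor. 3.12 p. 173–174; IUTchIV Thm. 1.10 p. 22–24]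
[claim: Mochizuki2012, status: disputed] -/
theorem not_deep_ratPoint_of_pow_le {l : ℕ} (T : Cor22.ThetaVolumeDatumAt (ratPoint q) l)
    (hI : ∀ p ∈ I, p.Prime) (hD : Dn = ∏ p ∈ I, p ^ e p) (hj : Cor22.jInv q = (N : ℚ) / (Dn : ℚ)) (hN : N ≠ 0)
    (hcop : ∀ p ∈ I, ¬ p ∣ N) (htail : ∀ p ∈ I, p ^ ((e p + 15) / 16 - 1) ≤ l) :
    letI := T.instFieldF; letI := T.instNumberFieldF; letI := T.instAlgebraF; letI := T.instFieldK
    letI := T.instNumberFieldK; letI := T.instAlgebraK; letI := T.instFieldFbar; letI := T.instAlgebraFbar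
    letI := T.instAlgebraKFbar; letI := T.instIsElliptic
    ¬ (∃ (pp : Nat.Primes) (_ : 2 < (pp : ℕ)) (i : Fin (thetaIndex (pilotDataOfK T.D T.K)).lstar)
        (x₀ : (thetaIndex (pilotDataOfK T.D T.K)).Fibre (.inr pp)),
      haveI : Fact (pp : ℕ).Prime := ⟨pp.2⟩
      ((pp : ℕ) : ℝ) ^ ((((i : ℕ) : ℝ) + 2) * (4 + 2 * Real.logb (pp : ℕ) (Module.finrank ℚ T.K)) + 1) *
        ‖(exists_realising_qIdeles_pilotDataOfK T.D).choose pp x₀‖ ^ (((i : ℕ) + 1) ^ 2 - 1) < 1) := by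
  refine not_deep_ratPoint_of_localHeight_le_log T hI hD hj hN hcop fun p hp => ?_
  have hlog : (e p + 15) / 16 - 1 ≤ Nat.log p l := Nat.le_log_of_pow_le (hI p hp).one_lt (htail p hp)
  omega

end RatPoint

/-! ## Instances: the Reyssat triple and F18 are in the window at EVERY `l` -/

section Instances

/-- **The Reyssat triple `2 + 3¹⁰·109 = 23⁵` is in the WINDOW at EVERY `l`**: `h = (20, 10, 2)` at `p = (3, 23, 109)`, `l₀^win = max(3¹, 23⁰, 109⁰) = 3`, and
`l ≥ 5` for every typed datum — so EVERY genuine Θ-volume datum at `(λ_R, l)`, any `l`, satisfies the window guard of `H⋆₂` / `hSHwBad` VERBATIM.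
Existence NOT claimed. [cite: Mochizuki2012, IUTchIII Cor. 3.12 p. 173–174; IUTchIV Thm. 1.10 p. 22–24] [claim: Mochizuki2012, status: disputed] -/
theorem not_deep_reyssat {l : ℕ} (T : Cor22.ThetaVolumeDatumAt (ratPoint (((2 : ℕ) : ℚ) / ((6436343 : ℕ) : ℚ))) l) :
    letI := T.instFieldF; letI := T.instNumberFieldF; letI := T.instAlgebraF; letI := T.instFieldK
    letI := T.instNumberFieldK; letI := T.instAlgebraK; letI := T.instFieldFbar; letI := T.instAlgebraFbar
    letI := T.instAlgebraKFbar; letI := T.instIsElliptic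
    ¬ (∃ (pp : Nat.Primes) (_ : 2 < (pp : ℕ)) (i : Fin (thetaIndex (pilotDataOfK T.D T.K)).lstar)
        (x₀ : (thetaIndex (pilotDataOfK T.D T.K)).Fibre (.inr pp)),
      haveI : Fact (pp : ℕ).Prime := ⟨pp.2⟩
      ((pp : ℕ) : ℝ) ^ ((((i : ℕ) : ℝ) + 2) * (4 + 2 * Real.logb (pp : ℕ) (Module.finrank ℚ T.K)) + 1) *
        ‖(exists_realising_qIdeles_pilotDataOfK T.D).choose pp x₀‖ ^ (((i : ℕ) + 1) ^ 2 - 1) < 1) := by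
  letI := T.instFieldF; letI := T.instNumberFieldF; letI := T.instAlgebraF; letI := T.instFieldK
  letI := T.instNumberFieldK; letI := T.instAlgebraK; letI := T.instFieldFbar; letI := T.instAlgebraFbar
  letI := T.instAlgebraKFbar; letI := T.instIsElliptic
  obtain ⟨hI, -, hD, hj, hN, hcop, -⟩ := factorisation_reyssat
  have h5 : 5 ≤ l := T.D.five_le_l
  refine not_deep_ratPoint_of_pow_le T hI hD hj hN hcop fun p hp => ?_
  simp only [Finset.mem_insert, Finset.mem_singleton] at hp
  rcases hp with rfl | rfl | rfl <;> norm_num <;> omega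

/-- **F18 `3·5⁶·7⁸·53 + 167⁹ = 2·11⁶·193⁴·20551` is in the WINDOW at every `l ≥ 167` by the closed form** (`h = (2,12,16,12,2,18,8,2)`; the only pole with
`h_p > 16` is `p = 167`, `h = 18`, so `l₀^win = 167¹`; at `l = 11, 13` parts 1–2 gave the window directly — the closed form is cruder than the degree-aware
criterion at small `l`). Existence NOT claimed. [cite: Mochizuki2012, IUTchIII Cor. 3.12 p. 173–174; IUTchIV Thm. 1.10 p. 22–24] [claim: Mochizuki2012, status: disputed] -/
theorem not_deep_F18_of_le {l : ℕ} (hl : 167 ≤ l)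
    (T : Cor22.ThetaVolumeDatumAt (ratPoint (((14321927484375 : ℕ) : ℚ) / ((101029522854437036222 : ℕ) : ℚ))) l) :
    letI := T.instFieldF; letI := T.instNumberFieldF; letI := T.instAlgebraF; letI := T.instFieldK
    letI := T.instNumberFieldK; letI := T.instAlgebraK; letI := T.instFieldFbar; letI := T.instAlgebraFbar
    letI := T.instAlgebraKFbar; letI := T.instIsElliptic
    ¬ (∃ (pp : Nat.Primes) (_ : 2 < (pp : ℕ)) (i : Fin (thetaIndex (pilotDataOfK T.D T.K)).lstar)
        (x₀ : (thetaIndex (pilotDataOfK T.D T.K)).Fibre (.inr pp)),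
      haveI : Fact (pp : ℕ).Prime := ⟨pp.2⟩
      ((pp : ℕ) : ℝ) ^ ((((i : ℕ) : ℝ) + 2) * (4 + 2 * Real.logb (pp : ℕ) (Module.finrank ℚ T.K)) + 1) *
        ‖(exists_realising_qIdeles_pilotDataOfK T.D).choose pp x₀‖ ^ (((i : ℕ) + 1) ^ 2 - 1) < 1) := by
  obtain ⟨hI, -, hD, hj, hN, hcop, -⟩ := factorisation_F18
  refine not_deep_ratPoint_of_pow_le T hI hD hj hN hcop fun p hp => ?_
  simp only [Finset.mem_insert, Finset.mem_singleton] at hp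
  rcases hp with rfl | rfl | rfl | rfl | rfl | rfl | rfl | rfl <;> norm_num <;> omega

end Instances

end Summit.ABC.IUTFork.Repair.RHSzpiroBadCutFreyResidue

end
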